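import Mathlib.Algebra.Order.BigOperators.Group.Finset
import Mathlib.Algebra.BigOperators.Group.Finset.Powerset
import Mathlib.Tactic.Linarith
import Mathlib.Tactic.Ring
import Summits.CriticalPhenomena.PercolationContinuityZ3.Theorems.PercNearOneGluingNoHeavyLowerTailSahiCTCKleitmanSurplus
import HarnessLib

/-!
# `NoHeavyLowerTail` (crux stmt-CriticalPhenomena-4575), P3 lane: the WEIGHTED (TOP-HEAVY) KLEITMAN LEMMA on a sub-cube

Support file (seat `prim-l12-p3`, gen 27; `--supports stmt-CriticalPhenomena-4575`).  Memo `run/shared/lean/prim/prim-l12/FROM-prim-l12-p3-g27-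
RT-MONOTONICITY.md` §2.  Setting of `…SahiCTCKleitmanSurplus`: for a family `𝒳 ⊆ 2^α`, a base `D` and a free finset `s`, the trace is
`tr 𝒳 D s = {U ⊆ s : D ∪ U ∈ 𝒳}`.  Kleitman's lemma in this language (`kap_nonneg` there) says that for two up-sets the number of "colourings"
`U ∈ tr 𝒳 D s` with `s \ U ∈ tr 𝒵 D s` is at most the number of common members `#(tr 𝒳 D s ∩ tr 𝒵 D s)`.

THIS FILE proves the WEIGHTED version, with two (possibly different) bases `D₁` (for `𝒳`) and `D₂` (for `𝒵`): for every weight `φ : Finset α → ℕ`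
that is monotone under inclusion,
    `∑_{U ∈ tr 𝒳 D₁ s, s \ U ∈ tr 𝒵 D₂ s} φ U ≤ ∑_{U ∈ tr 𝒳 D₁ s ∩ tr 𝒵 D₂ s} φ U`            (`sum_filter_sdiff_le_sum_inter`),
by induction on the free set: peeling `v ∈ s` splits both sides into a deletion part and a link part (`mem_tr_erase_iff`, `mem_tr_insert_iff` of
`…KleitmanSurplus`); the induction hypotheses for the MIXED pairs (link of `𝒳`, deletion of `𝒵`) and (deletion of `𝒳`, link of `𝒵`) are then
exchanged against the pure pairs pointwise, using `A⁰ ⊆ A¹`, `B⁰ ⊆ B¹` and `φ U ≤ φ (U + v)` (`weighted_exchange`).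
Corollary (`card_filter_sdiff_le_card_inter_of_le`, the TOP-HEAVY KLEITMAN LEMMA): for every threshold `c`,
    `#{U ∈ tr 𝒳 D₁ s : s \ U ∈ tr 𝒵 D₂ s ∧ c ≤ #U} ≤ #{U ∈ tr 𝒳 D₁ s ∩ tr 𝒵 D₂ s : c ≤ #U}`
— the surplus of Kleitman's lemma lives on the LARGE common sets.  (Level by level the inequality is false: `𝒳 = ↑{1}`, `𝒵 = ↑{2}` has one
colouring and no common set on level 1.)  This is the counting engine for the `R_t`-programme of the memo (the "loops-and-small-sets" half
`R_t = Θ_{t−1}(Π·Y_{≥t} − X·Z) + Π·X_{<t}·Z_{<t}` of the level-`t` certificate `M_t`).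
* `weighted_exchange` : the pointwise exchange `a'bφ¹ + ab'φ⁰ ≤ a'b'φ¹ + abφ⁰` for `a ≤ a'`, `b ≤ b'`, `φ⁰ ≤ φ¹` in `{0,1}`/`ℕ`;
* `sum_filter_sdiff_le_sum_inter` : the weighted Kleitman lemma (two bases, any monotone weight);
* `card_filter_sdiff_le_card_inter_of_le` : the top-heavy Kleitman lemma;  `card_filter_sdiff_le_card_inter` : Kleitman's lemma with two bases.
Nothing is asserted about the crux.
-/

namespace Summit.CriticalPhenomena.PercolationContinuityZ3.Theorems.SahiCTCForms

open Finset

variable {α : Type*} [DecidableEq α]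

/-! ### The pointwise exchange -/

/-- Pointwise exchange behind the weighted Kleitman lemma: for indicators `a ≤ a'`, `b ≤ b'` (in `ℕ`, at most `1`) and weights `φ⁰ ≤ φ¹`,
`a'·b·φ¹ + a·b'·φ⁰ ≤ a'·b'·φ¹ + a·b·φ⁰`. [this work] -/
theorem weighted_exchange {a a' b b' φ0 φ1 : ℕ} (ha : a ≤ a') (hb : b ≤ b') (hb' : b' ≤ 1) (hφ : φ0 ≤ φ1) :
    a' * b * φ1 + a * b' * φ0 ≤ a' * b' * φ1 + a * b * φ0 := by
  rcases Nat.eq_zero_or_pos b with rfl | hbpos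
  · rcases Nat.eq_zero_or_pos b' with rfl | hb'pos
    · simp
    · have hb1 : b' = 1 := le_antisymm hb' hb'pos
      subst hb1
      nlinarith [Nat.mul_le_mul ha hφ]
  · have hb1 : b = 1 := le_antisymm (hb.trans hb') hbpos
    have hb1' : b' = 1 := le_antisymm hb' (hbpos.trans_le (hb1 ▸ hb))
    subst hb1; subst hb1'
    simp

section Weighted
variable {𝒳 𝒵 : Finset (Finset α)}


/-- The indicator is at most `1`. [this work] -/
private theorem ind_le_one (𝒜 : Finset (Finset α)) (U : Finset α) : (if U ∈ 𝒜 then (1:ℕ) else 0) ≤ 1 := by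
  split_ifs <;> simp

/-- The indicator is monotone in the family. [this work] -/
private theorem ind_le_ind_of_subset {𝒜 ℬ : Finset (Finset α)} (h : 𝒜 ⊆ ℬ) (U : Finset α) : (if U ∈ 𝒜 then (1:ℕ) else 0) ≤ (if U ∈ ℬ then (1:ℕ) else 0) := by
  by_cases hU : U ∈ 𝒜
  · rw [if_pos hU, if_pos (h hU)]
  · rw [if_neg hU]; exact Nat.zero_le _

/-- A filtered sum over a trace as a sum over the powerset with indicators. [this work] -/
private theorem sum_filter_eq_sum_ind (D₁ D₂ s : Finset α) (φ : Finset α → ℕ) :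
    ∑ U ∈ (tr 𝒳 D₁ s).filter (fun U => s \ U ∈ tr 𝒵 D₂ s), φ U =
      ∑ U ∈ s.powerset, (if U ∈ tr 𝒳 D₁ s then (1:ℕ) else 0) * (if s \ U ∈ tr 𝒵 D₂ s then (1:ℕ) else 0) * φ U := by
  have hset : (tr 𝒳 D₁ s).filter (fun U => s \ U ∈ tr 𝒵 D₂ s) =
      s.powerset.filter (fun U => U ∈ tr 𝒳 D₁ s ∧ s \ U ∈ tr 𝒵 D₂ s) := by
    ext U
    simp only [mem_filter, mem_powerset]
    constructor
    · rintro ⟨h1, h2⟩; exact ⟨subset_of_mem_tr h1, h1, h2⟩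
    · rintro ⟨_, h1, h2⟩; exact ⟨h1, h2⟩
  rw [hset, sum_filter]
  refine sum_congr rfl fun U _ => ?_
  by_cases h1 : U ∈ tr 𝒳 D₁ s <;> by_cases h2 : s \ U ∈ tr 𝒵 D₂ s <;> simp [h1, h2]

/-- A sum over an intersection of traces as a sum over the powerset with indicators. [this work] -/
private theorem sum_inter_eq_sum_ind (D₁ D₂ s : Finset α) (φ : Finset α → ℕ) :
    ∑ U ∈ tr 𝒳 D₁ s ∩ tr 𝒵 D₂ s, φ U = ∑ U ∈ s.powerset, (if U ∈ tr 𝒳 D₁ s then (1:ℕ) else 0) * (if U ∈ tr 𝒵 D₂ s then (1:ℕ) else 0) * φ U := by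
  have hset : tr 𝒳 D₁ s ∩ tr 𝒵 D₂ s = s.powerset.filter (fun U => U ∈ tr 𝒳 D₁ s ∧ U ∈ tr 𝒵 D₂ s) := by
    ext U
    simp only [mem_inter, mem_filter, mem_powerset]
    constructor
    · rintro ⟨h1, h2⟩; exact ⟨subset_of_mem_tr h1, h1, h2⟩
    · rintro ⟨_, h1, h2⟩; exact ⟨h1, h2⟩
  rw [hset, sum_filter]
  refine sum_congr rfl fun U _ => ?_
  by_cases h1 : U ∈ tr 𝒳 D₁ s <;> by_cases h2 : U ∈ tr 𝒵 D₂ s <;> simp [h1, h2]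

/-- Indicator transport, deletion: for `v ∉ s'` and `U ⊆ s'`, membership in the trace on `insert v s'` is membership in the
trace on `s'`. [this work] -/
private theorem ind_tr_insert_of_subset {v : α} {s' D U : Finset α} (hv : v ∉ s') (hU : U ⊆ s') :
    (if U ∈ tr 𝒳 D (insert v s') then (1:ℕ) else 0) = (if U ∈ tr 𝒳 D s' then (1:ℕ) else 0) := by
  have hvU : v ∉ U := fun h => hv (hU h)
  have key : U ∈ tr 𝒳 D (insert v s') ↔ U ∈ tr 𝒳 D s' := by
    have h := (mem_tr_erase_iff (𝒳 := 𝒳) (D := D) (s := insert v s') (v := v) (U := U))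
    rw [erase_insert hv] at h
    exact ⟨fun h1 => h.2 ⟨hvU, h1⟩, fun h1 => (h.1 h1).2⟩
  simp only [key]

/-- Indicator transport, link: for `v ∉ s'` and `U ⊆ s'`, `U + v` lies in the trace on `(D, insert v s')` iff `U` lies in the trace on
`(D + v, s')`. [this work] -/
private theorem ind_tr_insert_insert {v : α} {s' D U : Finset α} (hv : v ∉ s') (hU : U ⊆ s') :
    (if insert v U ∈ tr 𝒳 D (insert v s') then (1:ℕ) else 0) = (if U ∈ tr 𝒳 (insert v D) s' then (1:ℕ) else 0) := by
  have hvU : v ∉ U := fun h => hv (hU h)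
  have key : insert v U ∈ tr 𝒳 D (insert v s') ↔ U ∈ tr 𝒳 (insert v D) s' := by
    have h := (mem_tr_insert_iff (𝒳 := 𝒳) (D := D) (s := insert v s') (v := v) (mem_insert_self v s') (R := U))
    rw [erase_insert hv] at h
    exact ⟨fun h1 => h.2 ⟨hvU, h1⟩, fun h1 => (h.1 h1).2⟩
  simp only [key]

/-- `(insert v s') \ U = insert v (s' \ U)` for `U ⊆ s'`, `v ∉ s'`. [this work] -/
private theorem insert_sdiff_of_subset {v : α} {s' U : Finset α} (hv : v ∉ s') (hU : U ⊆ s') :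
    insert v s' \ U = insert v (s' \ U) := by
  have hvU : v ∉ U := fun h => hv (hU h)
  ext x; simp only [mem_sdiff, mem_insert]
  constructor
  · rintro ⟨hx | hx, hxU⟩
    · exact Or.inl hx
    · exact Or.inr ⟨hx, hxU⟩
  · rintro (rfl | ⟨hx, hxU⟩)
    · exact ⟨Or.inl rfl, hvU⟩
    · exact ⟨Or.inr hx, hxU⟩

/-- `(insert v s') \ (insert v U) = s' \ U` for `v ∉ s'`. [this work] -/
private theorem insert_sdiff_insert_of_not_mem {v : α} {s' U : Finset α} (hv : v ∉ s') :
    insert v s' \ insert v U = s' \ U := by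
  ext x; simp only [mem_sdiff, mem_insert, not_or]
  constructor
  · rintro ⟨hx | hx, hxv, hxU⟩
    · exact absurd hx hxv
    · exact ⟨hx, hxU⟩
  · rintro ⟨hx, hxU⟩
    exact ⟨Or.inr hx, fun h => hv (h ▸ hx), hxU⟩

/-- **Weighted Kleitman lemma** (two bases, any monotone weight): for up-sets `𝒳, 𝒵`, bases `D₁, D₂`, a free finset `s` and a weight
`φ` monotone under inclusion, `∑_{U ∈ tr 𝒳 D₁ s, s \ U ∈ tr 𝒵 D₂ s} φ U ≤ ∑_{U ∈ tr 𝒳 D₁ s ∩ tr 𝒵 D₂ s} φ U`.  Induction on `s`: peel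
`v`, apply the hypothesis to the two mixed (link/deletion) pairs, exchange pointwise. [this work] -/
theorem sum_filter_sdiff_le_sum_inter (h𝒳 : IsUpperSet (𝒳 : Set (Finset α))) (h𝒵 : IsUpperSet (𝒵 : Set (Finset α)))
    (s : Finset α) : ∀ (D₁ D₂ : Finset α) (φ : Finset α → ℕ), Monotone φ →
    ∑ U ∈ (tr 𝒳 D₁ s).filter (fun U => s \ U ∈ tr 𝒵 D₂ s), φ U ≤ ∑ U ∈ tr 𝒳 D₁ s ∩ tr 𝒵 D₂ s, φ U := by
  induction s using Finset.induction_on with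
  | empty =>
    intro D₁ D₂ φ _
    apply le_of_eq
    apply sum_congr _ fun _ _ => rfl
    ext U
    simp only [mem_filter, mem_inter]
    constructor
    · rintro ⟨h1, h2⟩
      have hU : U = ∅ := subset_empty.1 (subset_of_mem_tr h1)
      subst hU; simpa using And.intro h1 h2
    · rintro ⟨h1, h2⟩
      have hU : U = ∅ := subset_empty.1 (subset_of_mem_tr h1)
      subst hU; simpa using And.intro h1 h2
  | @insert v s' hv ih =>
    intro D₁ D₂ φ hφ
    rw [sum_filter_eq_sum_ind, sum_inter_eq_sum_ind, sum_powerset_insert hv, sum_powerset_insert hv]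
    -- transport every indicator to the sub-cube `s'`
    have e1 : ∑ U ∈ s'.powerset, (if U ∈ tr 𝒳 D₁ (insert v s') then (1:ℕ) else 0) * (if insert v s' \ U ∈ tr 𝒵 D₂ (insert v s') then (1:ℕ) else 0) * φ U =
        ∑ U ∈ s'.powerset, (if U ∈ tr 𝒳 D₁ s' then (1:ℕ) else 0) * (if s' \ U ∈ tr 𝒵 (insert v D₂) s' then (1:ℕ) else 0) * φ U := by
      refine sum_congr rfl fun U hU => ?_
      have hUs : U ⊆ s' := mem_powerset.1 hU
      rw [ind_tr_insert_of_subset hv hUs, insert_sdiff_of_subset hv hUs, ind_tr_insert_insert hv sdiff_subset]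
    have e2 : ∑ U ∈ s'.powerset, (if insert v U ∈ tr 𝒳 D₁ (insert v s') then (1:ℕ) else 0) * (if insert v s' \ insert v U ∈ tr 𝒵 D₂ (insert v s') then (1:ℕ) else 0) *
          φ (insert v U) =
        ∑ U ∈ s'.powerset, (if U ∈ tr 𝒳 (insert v D₁) s' then (1:ℕ) else 0) * (if s' \ U ∈ tr 𝒵 D₂ s' then (1:ℕ) else 0) * φ (insert v U) := by
      refine sum_congr rfl fun U hU => ?_
      have hUs : U ⊆ s' := mem_powerset.1 hU
      rw [ind_tr_insert_insert hv hUs, insert_sdiff_insert_of_not_mem hv, ind_tr_insert_of_subset hv sdiff_subset]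
    have e3 : ∑ U ∈ s'.powerset, (if U ∈ tr 𝒳 D₁ (insert v s') then (1:ℕ) else 0) * (if U ∈ tr 𝒵 D₂ (insert v s') then (1:ℕ) else 0) * φ U =
        ∑ U ∈ s'.powerset, (if U ∈ tr 𝒳 D₁ s' then (1:ℕ) else 0) * (if U ∈ tr 𝒵 D₂ s' then (1:ℕ) else 0) * φ U := by
      refine sum_congr rfl fun U hU => ?_
      have hUs : U ⊆ s' := mem_powerset.1 hU
      rw [ind_tr_insert_of_subset hv hUs, ind_tr_insert_of_subset hv hUs]
    have e4 : ∑ U ∈ s'.powerset, (if insert v U ∈ tr 𝒳 D₁ (insert v s') then (1:ℕ) else 0) * (if insert v U ∈ tr 𝒵 D₂ (insert v s') then (1:ℕ) else 0) * φ (insert v U) =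
        ∑ U ∈ s'.powerset, (if U ∈ tr 𝒳 (insert v D₁) s' then (1:ℕ) else 0) * (if U ∈ tr 𝒵 (insert v D₂) s' then (1:ℕ) else 0) * φ (insert v U) := by
      refine sum_congr rfl fun U hU => ?_
      have hUs : U ⊆ s' := mem_powerset.1 hU
      rw [ind_tr_insert_insert hv hUs, ind_tr_insert_insert hv hUs]
    rw [e1, e2, e3, e4]
    -- the two induction hypotheses (mixed pairs), written with indicators
    have hφ' : Monotone (fun U : Finset α => φ (insert v U)) := fun U U' h => hφ (insert_subset_insert v h)
    have i1 := ih D₁ (insert v D₂) φ hφ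
    have i2 := ih (insert v D₁) D₂ (fun U => φ (insert v U)) hφ'
    rw [sum_filter_eq_sum_ind, sum_inter_eq_sum_ind] at i1 i2
    -- pointwise exchange
    have ex : ∑ U ∈ s'.powerset, (if U ∈ tr 𝒳 D₁ s' then (1:ℕ) else 0) * (if U ∈ tr 𝒵 (insert v D₂) s' then (1:ℕ) else 0) * φ U +
        ∑ U ∈ s'.powerset, (if U ∈ tr 𝒳 (insert v D₁) s' then (1:ℕ) else 0) * (if U ∈ tr 𝒵 D₂ s' then (1:ℕ) else 0) * φ (insert v U) ≤
        ∑ U ∈ s'.powerset, (if U ∈ tr 𝒳 D₁ s' then (1:ℕ) else 0) * (if U ∈ tr 𝒵 D₂ s' then (1:ℕ) else 0) * φ U +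
        ∑ U ∈ s'.powerset, (if U ∈ tr 𝒳 (insert v D₁) s' then (1:ℕ) else 0) * (if U ∈ tr 𝒵 (insert v D₂) s' then (1:ℕ) else 0) * φ (insert v U) := by
      rw [← sum_add_distrib, ← sum_add_distrib]
      refine sum_le_sum fun U _ => ?_
      have hA : (if U ∈ tr 𝒳 D₁ s' then (1:ℕ) else 0) ≤ (if U ∈ tr 𝒳 (insert v D₁) s' then (1:ℕ) else 0) := ind_le_ind_of_subset
        (fun W hW => mem_tr.2 ⟨subset_of_mem_tr hW, h𝒳 (union_subset_union (subset_insert v D₁) Subset.rfl) (mem_tr.1 hW).2⟩) U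
      have hB : (if U ∈ tr 𝒵 D₂ s' then (1:ℕ) else 0) ≤ (if U ∈ tr 𝒵 (insert v D₂) s' then (1:ℕ) else 0) := ind_le_ind_of_subset
        (fun W hW => mem_tr.2 ⟨subset_of_mem_tr hW, h𝒵 (union_subset_union (subset_insert v D₂) Subset.rfl) (mem_tr.1 hW).2⟩) U
      have hw := weighted_exchange hA hB (ind_le_one _ U) (hφ (subset_insert v U))
      linarith
    linarith

/-- **Top-heavy Kleitman lemma**: for up-sets `𝒳, 𝒵` and every threshold `c`, the colourings `U ∈ tr 𝒳 D₁ s` with `s \ U ∈ tr 𝒵 D₂ s`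
and `c ≤ #U` are no more than the common members `U ∈ tr 𝒳 D₁ s ∩ tr 𝒵 D₂ s` with `c ≤ #U`. [this work] -/
theorem card_filter_sdiff_le_card_inter_of_le (h𝒳 : IsUpperSet (𝒳 : Set (Finset α))) (h𝒵 : IsUpperSet (𝒵 : Set (Finset α)))
    (s D₁ D₂ : Finset α) (c : ℕ) :
    #((tr 𝒳 D₁ s).filter fun U => s \ U ∈ tr 𝒵 D₂ s ∧ c ≤ #U) ≤ #((tr 𝒳 D₁ s ∩ tr 𝒵 D₂ s).filter fun U => c ≤ #U) := by
  have hφ : Monotone (fun U : Finset α => if c ≤ #U then 1 else 0) := by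
    intro U U' h
    by_cases hc : c ≤ #U
    · have hc' : c ≤ #U' := hc.trans (card_le_card h)
      simp [hc, hc']
    · simp [hc]
  have h := sum_filter_sdiff_le_sum_inter h𝒳 h𝒵 s D₁ D₂ _ hφ
  rw [card_eq_sum_ones, card_eq_sum_ones, sum_filter, sum_filter]
  rw [sum_filter] at h
  simpa [ite_and] using h

/-- **Kleitman's lemma with two bases**: for up-sets, `#{U ∈ tr 𝒳 D₁ s : s \ U ∈ tr 𝒵 D₂ s} ≤ #(tr 𝒳 D₁ s ∩ tr 𝒵 D₂ s)`
(for `D₁ = D₂` this is `kap_nonneg` of `…KleitmanSurplus`). [folklore] -/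
theorem card_filter_sdiff_le_card_inter (h𝒳 : IsUpperSet (𝒳 : Set (Finset α))) (h𝒵 : IsUpperSet (𝒵 : Set (Finset α)))
    (s D₁ D₂ : Finset α) :
    #((tr 𝒳 D₁ s).filter fun U => s \ U ∈ tr 𝒵 D₂ s) ≤ #(tr 𝒳 D₁ s ∩ tr 𝒵 D₂ s) := by
  have h := sum_filter_sdiff_le_sum_inter h𝒳 h𝒵 s D₁ D₂ (fun _ => 1) (fun _ _ _ => le_rfl)
  simpa using h

end Weighted

end Summit.CriticalPhenomena.PercolationContinuityZ3.Theorems.SahiCTCForms
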